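import Mathlib
import HarnessLib
import Literature.Analysis.FluidPDE.RadialCalculus
import Literature.Analysis.FluidPDE.NewtonKernel
import Literature.Analysis.PDE.LoewnerNirenbergKelvin
import Literature.Analysis.FluidPDE.VorticityCalculus
import Literature.Analysis.FluidPDE.AncientSimilarityVorticity
import Literature.Analysis.FluidPDE.BiotSavartCurlPair
import Literature.Analysis.FluidPDE.AxisymGradientField
import Summits.NavierStokesRegularity.NavierStokesRegularity.Theorems.TypeIQuarterGateScarEnvelopeTypeIForcedTsaiDipoleTail
import Summits.NavierStokesRegularity.NavierStokesRegularity.Theorems.TypeIQuarterGateScarEnvelopeTypeIForcedTsaiStokesletSelfAdvection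

/-!
# ARM B — SO(3)-SECTOR IDENTITIES of the linearised Leray operators, kernel form: GENERAL degree,
  GENERAL radial profile (ns-wall-extremal, eng-2 lineage g3, 2026-08-29)

The pointwise identities behind the «SO(3) sector reduction» of eng-1 g4 LINEAR-FLOOR.md §2 and
eng-2 g2 LFD-CERT v6 §9 FACT-Z — the analytic ingredient of DATUM B-2j/B-2l/B-2n (class-free linear
floor `κ_lin = κ(1) ∈ [14.8582872, 14.8582893]` of the registered ARM-B currency pair
`…ForcedTsaiDefs`: level `‖curl U‖_{L²(B₁₀)}`, residual `‖(1+|y|)^{5/2} curl(−ΔU + ½U + ½y·∇U + U·∇U)‖`)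
that ns-wall-crit-1 g4 (2026-08-29T05:32:53Z, C4) recorded as «the one non-certified ingredient».
PRIOR ART IN THE TREE (cited, not restated): the ns-blowup AGL helper
`Theorems/RungBlowupCofinal/SolidHarmonicProfileOperator.lean`
(`Summit.NavierStokesRegularity.AngularGalerkinLadderSolidHarmonicProfileOperator.profileOp_toroidalLift`,
`…profileOp_gradientLift/radialLift/threeLift`, `…laplacian_radial_smul`, `…laplacian_smulSelf`,
`…laplacian_crossSelf_gradient_of_harmonic`, `…fderiv_crossSelf_gradient_self`) already gives the
VELOCITY-operator sector action on the three solid-harmonic lifts — in particular FACT-Z for every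
degree — under GLOBAL hypotheses `a, c ∈ C^∞(ℝ)`, `φ ∈ C^∞` (+ Euler's identity as a hypothesis).
THE DELTA OF THIS FILE: (a) LOCAL hypotheses — the profile `g` is only `C²` on an open set of radii,
so the identities hold on `ℝ³ ∖ {0}` for the SINGULAR Type-I profiles `r^{−J−1}(…)` that are the exact
zero modes of DATUM B-2j/B-2m (eng-1 g4/g6's `…DipoleTail`, `…StokesletTail`, `…ExactSwirlTail`,
`…SwirlZeroModeJ2` are instances), `P ∈ C³` positively homogeneous, general finite-dimensional `E`
with Euler's identity at a point; (b) the VORTICITY operator `A = −Δ + 1 + ½y·∇` (the toroidal-ω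
sectors `ℓ` of B-2j, `ℓ = 1` = the floor sector), absent from the AGL file; (c) the toroidal field as
a curl / its divergence.  The velocity-operator statements below (`laplacian_radial_smul`,
`fderiv_radial_smul_apply_self`, `laplacian_smul_id`, `laplacian_toroidal`, `fderiv_toroidal_apply_self`,
`linearisedLeray_radial_smul`, `linearisedLeray_toroidal`) are the local-hypothesis forms of the AGL
lemmas (same mathematics; the AGL statements cannot be instantiated at singular profiles, hence no
import is possible for them).

WHAT IS PROVED (theorem-only file; pointwise identities; standard axioms).  Notation:
`L U := −ΔU + ½U + ½DU[y]` (= `lerayMomentumResidual U` minus `convect U U`: the LINEAR part of the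
registered momentum residual), `A W := −ΔW + W + ½DW[y]` (linearised vorticity operator), `σ = ‖y‖²`.
* General finite-dimensional inner-product space `E`, radial profile `g ∈ C²` on an open set of
  radii `∋ σ`, field `Φ : E → F` that is `C²` at `x` and satisfies Euler's identity
  `DΦ(x)[x] = J • Φ(x)` at `x` (`J : ℝ`; e.g. `Φ` positively homogeneous of degree `J`):
  `fderiv_radial_smul_apply_self` : `D(g(σ)Φ)(x)[x] = (2σg′ + Jg) • Φ(x)`;
  `laplacian_radial_smul` : `Δ(g(σ)Φ)(x) = g ΔΦ(x) + (4σg″ + (2d + 4J)g′) • Φ(x)` (`d = dim E`);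
  for `Φ` harmonic at `x`:
  `linearisedLeray_radial_smul` : `L(g(σ)Φ)(x) = (−4σg″ − (2d+4J)g′ + σg′ + ((J+1)/2)g) • Φ(x)`,
  `linearisedVorticity_radial_smul` : `A(g(σ)Φ)(x) = (−4σg″ − (2d+4J)g′ + σg′ + (J/2+1)g) • Φ(x)`
  — every harmonic sector `{radial} · Φ` is INVARIANT and the operators act on the profile by an
  explicit second-order ODE operator depending on `Φ` only through its degree `J`.
* `ℝ³`, TOROIDAL sector `Φ_P(y) = ∇P(y) × y` of a `C³` positively `J`-homogeneous harmonic `P`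
  (solid harmonics are the instances; nothing polynomial is used): `toroidal_eq_curl`
  (`∇P × y = curl(P y)`, eng-1's `curl_smul_id`), `contDiff_toroidal`, `gradient_homogeneous` (`∇P(ty) = t^{J−1}∇P(y)`),
  `toroidal_homogeneous`, `fderiv_toroidal_apply_self` (Euler), `laplacian_smul_id`
  (`Δ(P y) = 2∇P`), `laplacian_toroidal` (`Δ(∇P × y) = 0`), `divergence_toroidal`,
  `inner_toroidal_self`; and the assembled sector laws
  ★ `linearisedLeray_toroidal` : `L(g(σ) • (∇P × y))(x) = (−4σg″ − (4J+6)g′ + σg′ + ((J+1)/2)g) • (∇P(x) × x)`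
    — in `r = √σ`, `χ(r) = g(r²)`, the bracket is `−[χ″ + ((2J+2)/r − r/2)χ′ − ((J+1)/2)χ]`:
    LFD-CERT §9 FACT-Z / DATUM B-2m FACT 1 for EVERY `J` (its zeros are the exact Type-I swirl tails
    `χ_dec ~ r^{−J−1}(1 + J(J+1)r⁻² + …)`; `J = 2` instance = tree `swirlZeroModeJ2_linearisedLerayProfile`);
  ★ `linearisedVorticity_toroidal` : `A(g(σ) • (∇P × y))(x) = (−4σg″ − (4J+6)g′ + σg′ + (J/2+1)g) • (∇P(x) × x)`
    — the toroidal-VORTICITY sector of degree `ℓ = J` (velocity poloidal; `ℓ = 1` = THE FLOOR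
    sector of B-2j): writing `W = f(r) · Φ_P(y)/r^J`, `f(r) = r^J g(r²)`, the right side is
    `(A_ℓ f)(r) · Φ_P(x)/r^J` with eng-1's `A_ℓ f = −f″ − 2f′/r + ℓ(ℓ+1)f/r² + f + ½ r f′`, and with
    `u = r f` the operator `T_ℓ u = −u″ + ½ r u′ + ½ u + ℓ(ℓ+1)u/r²` of the 1-D certificates
    (LFD-CERT CLAIM-T1…T4; checked by hand in the docstrings, the kernel statement is the `σ`-form).

WHAT IS NOT PROVED HERE.  The `L²`-orthogonality / block-diagonality of the two registered
quadratic forms over the sectors (the other half of «inf over all fields = min over sectors») —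
that stays eng-1 §2 on paper; the poloidal sector split (`curl(χ · Φ_P)` into the `ℓ = J ∓ 1`
vector harmonics) and `curl ∘ L = A ∘ curl` are the companion file `…SectorReductionCurl`.  MEANING: identity-grade (★ information), LINEAR order,
pointwise on `{σ ∈ U}`; excludes no profile, bounds no nonlinear modulus; crux `ScarEnvelopeTypeI`
(stmt-23843) / wall H3 OPEN; NS regularity NOT proved.

Tree search: reused `laplacian_comp_norm_sq`, `fderiv_comp_norm_sq_apply`,
`hasFDerivAt_comp_norm_sq` (`RadialCalculus`), `LoewnerNirenberg.laplacian_smul_apply`,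
`curl_laplacian`/`curl_smul`/`curl_const_smul` (`VorticityCalculus`), `fderiv_eq_innerSL_gradient`,
`inner_gradient_left` (`BiotSavartCurlPair`), `curlCLM_smulRight_innerSL` (`BiotSavartNewtonKernel`),
`contDiff_gradient_of_succ` (`AxisymGradientField`), `cross_smul_left/right` (`HyperbolicDSSOrbit`),
`curl_gradient_eq_zero_holds`, `divergence_curl_eq_zero_holds`, `contDiff_laplacian` (`NewtonKernel`),
`laplacian_clm`, `fderiv_apply_self_of_homogeneous`, `curl_smul_id` (eng-1 `…DipoleTail`/`…HomogeneousTail`/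
`…StokesletSelfAdvection`);
prior art `AngularGalerkinLadderSolidHarmonicProfileOperator.*` (C^∞ global forms, see above).
-/

noncomputable section

set_option linter.dupNamespace false

namespace Summit.NavierStokesRegularity.NavierStokesRegularity.Cruxes.ScarEnvelopeTypeI.ForcedTsai

namespace Sector

open scoped Laplacian RealInnerProductSpace InnerProductSpace ContDiff
open Literature.Analysis.FluidPDE Literature.Analysis.PDE Set Filter Topology

section General

variable {E : Type*} [NormedAddCommGroup E] [InnerProductSpace ℝ E] [FiniteDimensional ℝ E]
variable {F : Type*} [NormedAddCommGroup F] [NormedSpace ℝ F]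

omit [FiniteDimensional ℝ E] in
/-- A `C²` radial profile on an open set of radii makes `y ↦ g(‖y‖²)` `C²` at every point whose
squared norm lies in that set. -/
theorem contDiffAt_comp_norm_sq {g : ℝ → ℝ} {U : Set ℝ} (hU : IsOpen U) (hg : ContDiffOn ℝ 2 g U)
    {x : E} (hx : ‖x‖ ^ 2 ∈ U) : ContDiffAt ℝ 2 (fun y : E => g (‖y‖ ^ 2)) x :=
  (hg.contDiffAt (hU.mem_nhds hx)).comp x (contDiff_norm_sq ℝ (E := E)).contDiffAt

/-- Pointwise derivative of a `C²` profile on an open set of radii. -/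
theorem hasDerivAt_of_contDiffOn {g : ℝ → ℝ} {U : Set ℝ} (hU : IsOpen U) (hg : ContDiffOn ℝ 2 g U)
    {σ : ℝ} (hσ : σ ∈ U) : HasDerivAt g (deriv g σ) σ :=
  ((hg.differentiableOn (by norm_num)).differentiableAt (hU.mem_nhds hσ)).hasDerivAt

/-- Pointwise second derivative of a `C²` profile on an open set of radii. -/
theorem hasDerivAt_deriv_of_contDiffOn {g : ℝ → ℝ} {U : Set ℝ} (hU : IsOpen U)
    (hg : ContDiffOn ℝ 2 g U) {σ : ℝ} (hσ : σ ∈ U) :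
    HasDerivAt (deriv g) (deriv (deriv g) σ) σ := by
  have h1 : ContDiffOn ℝ 1 (deriv g) U := hg.deriv_of_isOpen hU (by norm_num)
  exact ((h1.differentiableOn one_ne_zero).differentiableAt (hU.mem_nhds hσ)).hasDerivAt

omit [FiniteDimensional ℝ E] in
/-- **First derivative of a sector field along the position vector.**  For a radial profile `g`
differentiable at `σ = ‖x‖²` and a field `Φ` differentiable at `x` satisfying Euler's identity
`DΦ(x)[x] = J • Φ(x)` there (e.g. `Φ` positively homogeneous of degree `J`):
`D(g(‖·‖²)Φ)(x)[x] = (2σ g′(σ) + J g(σ)) • Φ(x)`. -/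
theorem fderiv_radial_smul_apply_self {g : ℝ → ℝ} {g₁ : ℝ} {x : E}
    (hg : HasDerivAt g g₁ (‖x‖ ^ 2)) {Φ : E → F} (hΦ : DifferentiableAt ℝ Φ x) {J : ℝ}
    (hE : fderiv ℝ Φ x x = J • Φ x) :
    fderiv ℝ (fun y : E => g (‖y‖ ^ 2) • Φ y) x x
      = (2 * ‖x‖ ^ 2 * g₁ + J * g (‖x‖ ^ 2)) • Φ x := by
  have hφ := hasFDerivAt_comp_norm_sq (E := E) hg
  have hU : HasFDerivAt (fun y : E => g (‖y‖ ^ 2) • Φ y)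
      (g (‖x‖ ^ 2) • fderiv ℝ Φ x + (((2 * g₁) • (innerSL ℝ x : E →L[ℝ] ℝ))).smulRight (Φ x)) x :=
    hφ.smul hΦ.hasFDerivAt
  rw [hU.fderiv]
  rw [show (g (‖x‖ ^ 2) • fderiv ℝ Φ x + ((2 * g₁) • (innerSL ℝ x : E →L[ℝ] ℝ)).smulRight (Φ x)) x
      = g (‖x‖ ^ 2) • fderiv ℝ Φ x x + ((2 * g₁) * ⟪x, x⟫) • Φ x from rfl, hE,
    real_inner_self_eq_norm_sq, smul_smul, ← add_smul]
  congr 1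
  ring

/-- **Laplacian of a sector field.**  For a radial profile `g ∈ C²` on an open set of radii
containing `σ = ‖x‖²` and a field `Φ`, `C²` at `x`, with Euler's identity `DΦ(x)[x] = J • Φ(x)`:
`Δ(g(‖·‖²)Φ)(x) = g(σ) ΔΦ(x) + (4σ g″(σ) + (2d + 4J) g′(σ)) Φ(x)`, `d = dim E`
(Leibniz rule; the cross term `2 DΦ(x)[∇(g∘‖·‖²)(x)] = 4 g′(σ) DΦ(x)[x]` is where Euler's
identity enters). -/
theorem laplacian_radial_smul {g : ℝ → ℝ} {U : Set ℝ} (hU : IsOpen U) (hg : ContDiffOn ℝ 2 g U)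
    {x : E} (hx : ‖x‖ ^ 2 ∈ U) {Φ : E → F} (hΦ : ContDiffAt ℝ 2 Φ x) {J : ℝ}
    (hE : fderiv ℝ Φ x x = J • Φ x) :
    (Δ (fun y : E => g (‖y‖ ^ 2) • Φ y)) x =
      g (‖x‖ ^ 2) • (Δ Φ) x
        + (4 * ‖x‖ ^ 2 * deriv (deriv g) (‖x‖ ^ 2)
            + (2 * (Module.finrank ℝ E) + 4 * J) * deriv g (‖x‖ ^ 2)) • Φ x := by
  set b := stdOrthonormalBasis ℝ E with hb
  have hφ := contDiffAt_comp_norm_sq (E := E) hU hg hx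
  have hd : ∀ σ ∈ U, HasDerivAt g (deriv g σ) σ := fun σ hσ => hasDerivAt_of_contDiffOn hU hg hσ
  have hd2 := hasDerivAt_deriv_of_contDiffOn hU hg hx
  rw [LoewnerNirenberg.laplacian_smul_apply hφ hΦ b]
  -- first derivatives of the radial factor and the cross term
  have hd1 : ∀ i, fderiv ℝ (fun y : E => g (‖y‖ ^ 2)) x (b i) = 2 * deriv g (‖x‖ ^ 2) * ⟪x, b i⟫ :=
    fun i => fderiv_comp_norm_sq_apply (hd _ hx) (b i)
  have hx_repr : ∑ i, ⟪x, b i⟫ • b i = x := by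
    conv_rhs => rw [← b.sum_repr' x]
    exact Finset.sum_congr rfl fun i _ => by rw [real_inner_comm]
  have hΦd : DifferentiableAt ℝ Φ x := hΦ.differentiableAt (by norm_num)
  have hsum : ∑ i, (fderiv ℝ (fun y : E => g (‖y‖ ^ 2)) x (b i)) • fderiv ℝ Φ x (b i)
      = (2 * deriv g (‖x‖ ^ 2) * J) • Φ x := by
    calc ∑ i, (fderiv ℝ (fun y : E => g (‖y‖ ^ 2)) x (b i)) • fderiv ℝ Φ x (b i)
        = ∑ i, (2 * deriv g (‖x‖ ^ 2)) • fderiv ℝ Φ x (⟪x, b i⟫ • b i) :=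
          Finset.sum_congr rfl fun i _ => by rw [hd1, map_smul, smul_smul]
      _ = (2 * deriv g (‖x‖ ^ 2)) • fderiv ℝ Φ x x := by
          rw [← Finset.smul_sum, ← map_sum, hx_repr]
      _ = _ := by rw [hE, smul_smul]
  -- the Laplacian of the radial factor
  have hΔφ : (Δ (fun y : E => g (‖y‖ ^ 2))) x
      = 4 * deriv (deriv g) (‖x‖ ^ 2) * ‖x‖ ^ 2 + 2 * (Module.finrank ℝ E) * deriv g (‖x‖ ^ 2) :=
    laplacian_comp_norm_sq (E := E) (g := g) (g₁ := deriv g) hU hd hx hd2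
  rw [hsum, hΔφ, smul_smul]
  have key : 4 * ‖x‖ ^ 2 * deriv (deriv g) (‖x‖ ^ 2)
        + (2 * (Module.finrank ℝ E) + 4 * J) * deriv g (‖x‖ ^ 2)
      = (4 * deriv (deriv g) (‖x‖ ^ 2) * ‖x‖ ^ 2 + 2 * (Module.finrank ℝ E) * deriv g (‖x‖ ^ 2))
        + 2 * (2 * deriv g (‖x‖ ^ 2) * J) := by ring
  rw [key]
  simp only [add_smul]
  abel

/-- **The linearised Leray PROFILE (velocity) operator on a harmonic sector field.**  With
`L U := −ΔU + ½U + ½DU[y]` (the left side of Leray's profile system `IsLerayProfile 1 ½` without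
pressure and without the convective term), a radial profile `g ∈ C²` near `σ = ‖x‖² ` and a field
`Φ`, `C²` at `x`, harmonic at `x` and satisfying Euler's identity of degree `J` at `x`:
`L(g(‖·‖²)Φ)(x) = (−4σ g″ − (2d + 4J) g′ + σ g′ + ((J+1)/2) g)(σ) • Φ(x)`.  In dimension `d = 3`
and in the variable `r = √σ` (`χ(r) = g(r²)`) the bracket is
`−χ″ − ((2J+2)/r − r/2)χ′ + ((J+1)/2)χ` — the radial operator of LFD-CERT §9 FACT-Z / B-2m FACT 1
for the toroidal field `Φ = y × ∇P_J` (see `linearisedLeray_toroidal`). -/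
theorem linearisedLeray_radial_smul {g : ℝ → ℝ} {U : Set ℝ} (hU : IsOpen U)
    (hg : ContDiffOn ℝ 2 g U) {x : E} (hx : ‖x‖ ^ 2 ∈ U) {Φ : E → F} (hΦ : ContDiffAt ℝ 2 Φ x)
    {J : ℝ} (hE : fderiv ℝ Φ x x = J • Φ x) (hΔ : (Δ Φ) x = 0) :
    -((Δ (fun y : E => g (‖y‖ ^ 2) • Φ y)) x) + (1 / 2 : ℝ) • (g (‖x‖ ^ 2) • Φ x)
        + (1 / 2 : ℝ) • fderiv ℝ (fun y : E => g (‖y‖ ^ 2) • Φ y) x x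
      = (-(4 * ‖x‖ ^ 2 * deriv (deriv g) (‖x‖ ^ 2))
          - (2 * (Module.finrank ℝ E) + 4 * J) * deriv g (‖x‖ ^ 2)
          + ‖x‖ ^ 2 * deriv g (‖x‖ ^ 2) + (J + 1) / 2 * g (‖x‖ ^ 2)) • Φ x := by
  have hΦd : DifferentiableAt ℝ Φ x := hΦ.differentiableAt (by norm_num)
  rw [laplacian_radial_smul hU hg hx hΦ hE, hΔ, smul_zero, zero_add,
    fderiv_radial_smul_apply_self (hasDerivAt_of_contDiffOn hU hg hx) hΦd hE, smul_smul, smul_smul,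
    ← neg_smul, ← add_smul, ← add_smul]
  congr 1
  ring

/-- **The linearised Leray VORTICITY operator on a harmonic sector field.**  With
`A W := −ΔW + W + ½DW[y]` (the operator with `curl ∘ L = A ∘ curl`, DATUM B-2j; companion file
`…SectorReductionCurl`), `g ∈ C²` near `σ = ‖x‖²`, `Φ` `C²`, harmonic and Euler of degree `J` at `x`:
`A(g(‖·‖²)Φ)(x) = (−4σ g″ − (2d + 4J) g′ + σ g′ + (J/2 + 1) g)(σ) • Φ(x)` (for `d = 3` and the
toroidal field see `linearisedVorticity_toroidal` and the module docstring). -/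
theorem linearisedVorticity_radial_smul {g : ℝ → ℝ} {U : Set ℝ} (hU : IsOpen U)
    (hg : ContDiffOn ℝ 2 g U) {x : E} (hx : ‖x‖ ^ 2 ∈ U) {Φ : E → F} (hΦ : ContDiffAt ℝ 2 Φ x)
    {J : ℝ} (hE : fderiv ℝ Φ x x = J • Φ x) (hΔ : (Δ Φ) x = 0) :
    -((Δ (fun y : E => g (‖y‖ ^ 2) • Φ y)) x) + g (‖x‖ ^ 2) • Φ x
        + (1 / 2 : ℝ) • fderiv ℝ (fun y : E => g (‖y‖ ^ 2) • Φ y) x x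
      = (-(4 * ‖x‖ ^ 2 * deriv (deriv g) (‖x‖ ^ 2))
          - (2 * (Module.finrank ℝ E) + 4 * J) * deriv g (‖x‖ ^ 2)
          + ‖x‖ ^ 2 * deriv g (‖x‖ ^ 2) + (J / 2 + 1) * g (‖x‖ ^ 2)) • Φ x := by
  have hΦd : DifferentiableAt ℝ Φ x := hΦ.differentiableAt (by norm_num)
  rw [laplacian_radial_smul hU hg hx hΦ hE, hΔ, smul_zero, zero_add,
    fderiv_radial_smul_apply_self (hasDerivAt_of_contDiffOn hU hg hx) hΦd hE, smul_smul,
    ← neg_smul, ← add_smul, ← add_smul]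
  congr 1
  ring

end General

/-! ## `ℝ³`: the TOROIDAL sector field `Φ_P(y) = ∇P(y) × y` of a solid harmonic `P` of degree `J`

Hypotheses used below for the «solid harmonic»: `P : ℝ³ → ℝ` of class `C³`, positively homogeneous
of degree `J : ℕ` (`P (t • y) = t ^ J * P y` for `t > 0`) and harmonic (`ΔP = 0`).  Homogeneous
harmonic POLYNOMIALS are the intended instances; nothing polynomial is used.  The toroidal field is
written `cross (gradient P y) y` (`= ∇P × y = curl (P y) = −(y × ∇P)`), the W1-skeleton convention
`curl v = ∇T × (x − x₀)`. -/

section Toroidal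

/-- The toroidal field as a function is the curl of `y ↦ P(y) y`. -/
theorem toroidal_eq_curl {P : E3 → ℝ} (hP : Differentiable ℝ P) :
    (fun y : E3 => cross (gradient P y) y) = curl (fun y : E3 => P y • y) :=
  funext fun x => (curl_smul_id (hP x)).symm

/-- Regularity: `P ∈ C^{n+1}` ⇒ `∇P × y ∈ Cⁿ`. -/
theorem contDiff_toroidal {P : E3 → ℝ} {n : ℕ∞} (hP : ContDiff ℝ ((n : WithTop ℕ∞) + 1) P) :
    ContDiff ℝ n (fun y : E3 => cross (gradient P y) y) := by
  have hg : ContDiff ℝ n (gradient P) := contDiff_gradient_of_succ hP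
  have h : ContDiff ℝ n (fun y : E3 => crossCLM (gradient P y) y) :=
    crossCLM.isBoundedBilinearMap.contDiff.comp (hg.prodMk contDiff_id)
  simpa only [crossCLM_apply] using h

/-- **The gradient of a positively `J`-homogeneous function is `(J−1)`-homogeneous**:
`∇P(t y) = t^{J−1} ∇P(y)` for `t > 0` (differentiate `P(t y) = t^J P(y)` in `y`). -/
theorem gradient_homogeneous {P : E3 → ℝ} (hP : Differentiable ℝ P) {J : ℕ}
    (hhom : ∀ t : ℝ, 0 < t → ∀ y : E3, P (t • y) = t ^ J * P y) {t : ℝ} (ht : 0 < t) (y : E3) :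
    gradient P (t • y) = (t ^ ((J : ℤ) - 1)) • gradient P y := by
  have h1 : HasFDerivAt (fun z : E3 => P (t • z))
      ((fderiv ℝ P (t • y)).comp (t • ContinuousLinearMap.id ℝ E3)) y :=
    (hP (t • y)).hasFDerivAt.comp y ((hasFDerivAt_id y).const_smul t)
  have h2 : HasFDerivAt (fun z : E3 => t ^ J * P z) ((t ^ J) • fderiv ℝ P y) y :=
    (hP y).hasFDerivAt.const_smul (t ^ J)
  have heq : (fun z : E3 => P (t • z)) = fun z : E3 => t ^ J * P z := funext (hhom t ht)
  rw [heq] at h1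
  have hD : (fderiv ℝ P (t • y)).comp (t • ContinuousLinearMap.id ℝ E3) = (t ^ J) • fderiv ℝ P y :=
    h1.unique h2
  have hD' : fderiv ℝ P (t • y) = (t ^ ((J : ℤ) - 1)) • fderiv ℝ P y := by
    ext v
    have hv : fderiv ℝ P (t • y) (t • v) = t ^ J * fderiv ℝ P y v := DFunLike.congr_fun hD v
    rw [map_smul, smul_eq_mul] at hv
    rw [show ((t ^ ((J : ℤ) - 1)) • fderiv ℝ P y) v = t ^ ((J : ℤ) - 1) * fderiv ℝ P y v from rfl,
      zpow_sub_one₀ ht.ne', zpow_natCast]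
    field_simp
    linear_combination hv
  rw [gradient, hD', map_smul, ← gradient]

/-- **The toroidal field of a `J`-homogeneous `P` is `J`-homogeneous**: `Φ_P(t y) = t^J Φ_P(y)`,
`t > 0`. -/
theorem toroidal_homogeneous {P : E3 → ℝ} (hP : Differentiable ℝ P) {J : ℕ}
    (hhom : ∀ t : ℝ, 0 < t → ∀ y : E3, P (t • y) = t ^ J * P y) {t : ℝ} (ht : 0 < t) (y : E3) :
    cross (gradient P (t • y)) (t • y) = (t ^ (J : ℤ)) • cross (gradient P y) y := by
  rw [gradient_homogeneous hP hhom ht y, cross_smul_left, cross_smul_right, smul_smul,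
    ← zpow_add_one₀ ht.ne', sub_add_cancel]

/-- **Euler's identity for the toroidal field**: `DΦ_P(x)[x] = J • Φ_P(x)`. -/
theorem fderiv_toroidal_apply_self {P : E3 → ℝ} (hP : ContDiff ℝ 2 P) {J : ℕ}
    (hhom : ∀ t : ℝ, 0 < t → ∀ y : E3, P (t • y) = t ^ J * P y) (x : E3) :
    fderiv ℝ (fun y : E3 => cross (gradient P y) y) x x = (J : ℝ) • cross (gradient P x) x := by
  have hPd : Differentiable ℝ P := hP.differentiable (by norm_num)
  have hd : DifferentiableAt ℝ (fun y : E3 => cross (gradient P y) y) x :=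
    ((contDiff_toroidal (n := 1) (by exact_mod_cast hP)).differentiable one_ne_zero).differentiableAt
  have h := fderiv_apply_self_of_homogeneous (U := fun y : E3 => cross (gradient P y) y) (y := x)
    (J : ℤ) (fun t ht => toroidal_homogeneous hPd hhom ht x) hd
  simpa using h

/-- The gradient expanded in an orthonormal basis: `∇P(x) = Σᵢ (∂_{bᵢ}P)(x) bᵢ`. -/
theorem gradient_eq_sum_fderiv_smul {ι : Type*} [Fintype ι] (b : OrthonormalBasis ι ℝ E3)
    (P : E3 → ℝ) (x : E3) : gradient P x = ∑ i, fderiv ℝ P x (b i) • b i := by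
  conv_lhs => rw [← b.sum_repr' (gradient P x)]
  refine Finset.sum_congr rfl fun i _ => ?_
  rw [real_inner_comm, inner_gradient_left]

/-- **`Δ(P y) = 2 ∇P + (ΔP) y`**; for harmonic `P`: `Δ(P y) = 2∇P`. -/
theorem laplacian_smul_id {P : E3 → ℝ} (hP : ContDiff ℝ 2 P) (hΔP : ∀ y, (Δ P) y = 0) :
    Δ (fun y : E3 => P y • y) = fun y : E3 => (2 : ℝ) • gradient P y := by
  funext x
  set b := EuclideanSpace.basisFun (Fin 3) ℝ
  have hid : ContDiffAt ℝ 2 (fun y : E3 => y) x := contDiffAt_id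
  have hΔid : (Δ (fun y : E3 => y)) x = 0 := laplacian_clm (ContinuousLinearMap.id ℝ E3) x
  rw [LoewnerNirenberg.laplacian_smul_apply hP.contDiffAt hid b, hΔP, zero_smul, zero_add, hΔid,
    smul_zero, add_zero, gradient_eq_sum_fderiv_smul b P x]
  refine congrArg _ (Finset.sum_congr rfl fun i _ => ?_)
  rw [fderiv_fun_id, ContinuousLinearMap.id_apply]

/-- **The toroidal field of a `C³` harmonic `P` is harmonic**: `Δ(∇P × y) = 0`
(`∇P × y = curl(P y)`, `curl Δ = Δ curl`, `Δ(P y) = 2∇P`, `curl ∇ = 0`). -/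
theorem laplacian_toroidal {P : E3 → ℝ} (hP : ContDiff ℝ 3 P) (hΔP : ∀ y, (Δ P) y = 0) (x : E3) :
    (Δ (fun y : E3 => cross (gradient P y) y)) x = 0 := by
  have hP2 : ContDiff ℝ 2 P := hP.of_le (by norm_num)
  have hPy : ContDiff ℝ 3 (fun y : E3 => P y • y) := hP.smul contDiff_id
  rw [toroidal_eq_curl (hP.differentiable (by norm_num)), ← curl_laplacian hPy x,
    laplacian_smul_id hP2 hΔP,
    curl_const_smul ((contDiff_gradient_of_succ (n := 1) (by exact_mod_cast hP2)).differentiable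
      one_ne_zero x) (2 : ℝ), curl_gradient_eq_zero_holds P hP2 x, smul_zero]

/-- The toroidal field is divergence free: `div (∇P × y) = div curl (P y) = 0`. -/
theorem divergence_toroidal {P : E3 → ℝ} (hP : ContDiff ℝ 2 P) (x : E3) :
    VectorCalculus.divergence (fun y : E3 => cross (gradient P y) y) x = 0 := by
  rw [toroidal_eq_curl (hP.differentiable (by norm_num))]
  exact divergence_curl_eq_zero_holds _ (hP.smul contDiff_id) x

/-- The toroidal field is tangent to spheres: `⟪∇P(x) × x, x⟫ = 0`. -/
theorem inner_toroidal_self (P : E3 → ℝ) (x : E3) : ⟪cross (gradient P x) x, x⟫ = 0 := by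
  have hI : ∀ a b : E3, ⟪a, b⟫ = a 0 * b 0 + a 1 * b 1 + a 2 * b 2 := fun a b => by
    simp [EuclideanSpace.inner_eq_star_dotProduct, dotProduct, Fin.sum_univ_three, mul_comm]
  rw [hI]
  simp [cross, cross_apply]
  ring

/-- ★ **FACT-Z for every degree `J` (LFD-CERT v6 §9 / DATUM B-2m FACT 1, kernel form): the
linearised Leray PROFILE operator maps the toroidal («swirl») sector of degree `J` to itself, acting
on the radial profile by a second-order ODE operator.**  For a `C³` positively `J`-homogeneous
harmonic `P`, a radial profile `g ∈ C²` on an open set of radii containing `σ = ‖x‖²`, and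
`U(y) := g(‖y‖²) • (∇P(y) × y)`:
`−ΔU(x) + ½U(x) + ½DU(x)[x] = (−4σ g″(σ) − (4J+6) g′(σ) + σ g′(σ) + ((J+1)/2) g(σ)) • (∇P(x) × x)`.
In `r = √σ`, `χ(r) := g(r²)`: the bracket is `−[χ″ + ((2J+2)/r − r/2)χ′ − ((J+1)/2)χ]`, the operator
of B-2m FACT 1 (its zeros `χ_dec ~ r^{−J−1}(1 + J(J+1)r⁻² + …)` are the exact Type-I swirl tails;
`J = 2`: tree `swirlZeroModeJ2_linearisedLerayProfile`).  LINEAR order only; pointwise. -/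
theorem linearisedLeray_toroidal {P : E3 → ℝ} (hP : ContDiff ℝ 3 P) {J : ℕ}
    (hhom : ∀ t : ℝ, 0 < t → ∀ y : E3, P (t • y) = t ^ J * P y) (hΔP : ∀ y, (Δ P) y = 0)
    {g : ℝ → ℝ} {U : Set ℝ} (hU : IsOpen U) (hg : ContDiffOn ℝ 2 g U) {x : E3} (hx : ‖x‖ ^ 2 ∈ U) :
    -((Δ (fun y : E3 => g (‖y‖ ^ 2) • cross (gradient P y) y)) x)
        + (1 / 2 : ℝ) • (g (‖x‖ ^ 2) • cross (gradient P x) x)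
        + (1 / 2 : ℝ) • fderiv ℝ (fun y : E3 => g (‖y‖ ^ 2) • cross (gradient P y) y) x x
      = (-(4 * ‖x‖ ^ 2 * deriv (deriv g) (‖x‖ ^ 2)) - (4 * J + 6) * deriv g (‖x‖ ^ 2)
          + ‖x‖ ^ 2 * deriv g (‖x‖ ^ 2) + (J + 1) / 2 * g (‖x‖ ^ 2)) • cross (gradient P x) x := by
  have hΦ : ContDiffAt ℝ 2 (fun y : E3 => cross (gradient P y) y) x :=
    (contDiff_toroidal (n := 2) (by exact_mod_cast hP)).contDiffAt
  rw [linearisedLeray_radial_smul hU hg hx hΦ (fderiv_toroidal_apply_self (hP.of_le (by norm_num))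
    hhom x) (laplacian_toroidal hP hΔP x), finrank_euclideanSpace_fin]
  congr 1
  push_cast
  ring

/-- ★ **The linearised VORTICITY operator on the toroidal sector** (the «toroidal-ω sector ℓ = J»
of LINEAR-FLOOR §2 — the FLOOR sector for `J = 1`): with `W(y) := g(‖y‖²) • (∇P(y) × y)`,
`−ΔW(x) + W(x) + ½DW(x)[x] = (−4σ g″ − (4J+6) g′ + σ g′ + (J/2+1) g)(σ) • (∇P(x) × x)`, `σ = ‖x‖²`.
Writing `W = f(r) · (∇P × y)/r^J` with `f(r) = r^J g(r²)` (`r = √σ`, `ℓ = J`), the right side is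
`(A_ℓ f)(r) · (∇P(x) × x)/r^J` with eng-1's `A_ℓ f = −f″ − 2f′/r + ℓ(ℓ+1)f/r² + f + ½ r f′`, and
with `u = r f` the 1-D operator `T_ℓ u = −u″ + ½ r u′ + ½ u + ℓ(ℓ+1)u/r²` of LFD-CERT CLAIM-T1…T4
(substitutions checked by hand; the kernel statement is the `σ`-form). -/
theorem linearisedVorticity_toroidal {P : E3 → ℝ} (hP : ContDiff ℝ 3 P) {J : ℕ}
    (hhom : ∀ t : ℝ, 0 < t → ∀ y : E3, P (t • y) = t ^ J * P y) (hΔP : ∀ y, (Δ P) y = 0)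
    {g : ℝ → ℝ} {U : Set ℝ} (hU : IsOpen U) (hg : ContDiffOn ℝ 2 g U) {x : E3} (hx : ‖x‖ ^ 2 ∈ U) :
    -((Δ (fun y : E3 => g (‖y‖ ^ 2) • cross (gradient P y) y)) x)
        + g (‖x‖ ^ 2) • cross (gradient P x) x
        + (1 / 2 : ℝ) • fderiv ℝ (fun y : E3 => g (‖y‖ ^ 2) • cross (gradient P y) y) x x
      = (-(4 * ‖x‖ ^ 2 * deriv (deriv g) (‖x‖ ^ 2)) - (4 * J + 6) * deriv g (‖x‖ ^ 2)
          + ‖x‖ ^ 2 * deriv g (‖x‖ ^ 2) + (J / 2 + 1) * g (‖x‖ ^ 2)) • cross (gradient P x) x := by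
  have hΦ : ContDiffAt ℝ 2 (fun y : E3 => cross (gradient P y) y) x :=
    (contDiff_toroidal (n := 2) (by exact_mod_cast hP)).contDiffAt
  rw [linearisedVorticity_radial_smul hU hg hx hΦ (fderiv_toroidal_apply_self
    (hP.of_le (by norm_num)) hhom x) (laplacian_toroidal hP hΔP x), finrank_euclideanSpace_fin]
  congr 1
  push_cast
  ring

end Toroidal

end Sector

end Summit.NavierStokesRegularity.NavierStokesRegularity.Cruxes.ScarEnvelopeTypeI.ForcedTsai

end
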